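import Literature.Probability.LatticeModels.RandomClusterBoundaryPushingTools
import HarnessLib

/-!
# Pushing boundary conditions across a collar: shrinking the domain of a free measure (proved)

Topic `Literature/Probability/LatticeModels` (trunk `StatMech`, family `crit-ising`). The second half
of Kesten's monotone boundary-condition toolkit (H. Kesten, *The incipient infinite cluster in
two-dimensional percolation*, PTRF 73 (1986), Lemma (29) and proof of Lemma (23)), companion of
`RandomClusterBoundaryPushing.lean`, for the FREE random-cluster measure `φ^∅_{⟨E⟩,p,q}`, `q ≥ 1`, of
the graph spanned by a finite edge set `E`, in the abstract collar geometry of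
`RandomClusterBoundaryPushingTools.lean` (core `Core`, collar `Ann`, `EA` = the `E`-edges touching the
collar, `EC` = the `E`-edges inside the core). The RSW-type input is clause (i) of the tree's annulus
estimates: conditionally on every cylinder of the edges off `EA`, with `φ^∅_{⟨E⟩}`-probability `≥ c`
the collar contains an open SEPARATOR — a vertex set `P ⊆ Ann`, pairwise open-connected inside `Ann`,
met by every `⟨E⟩`-walk from the core to the outside of `Core ∪ Ann`.

* `rcMeasure_real_free_le_free_core_of_sepBound` — (B) for DECREASING `D` determined on `EC`,
  `c · φ^∅_{⟨E⟩}(D) ≤ φ^∅_{⟨EC⟩}(D)`: the big free measure is, up to the constant, dominated on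
  decreasing core events by the free measure of the core alone.

Proof. (1) `φ(D ∖ Sep) ≤ (1 - c) φ(D)` by summing the hypothesis over the cylinders of `D`
(`rcMeasure_real_inter_le_mul_of_cylinder_le`). (2) On `Sep`, the exploration of the collar FROM
OUTSIDE (`explSet Rest Ann`, `Rest = (Core ∪ Ann)ᶜ`) has its rim WIRED FROM INSIDE
(`explRimWired_of_separating`), so `D ∩ Sep` is covered by the datum events `{𝒞 = X, 𝒟 = Y}` cut by
the wiring event; on each, the free rim Markov property (`rcMeasure_real_inter_eq_mul_of_rim_wired`)
makes the unexplored configuration the random-cluster configuration of the edges off `X` with the rim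
`Y` wired; drop the wiring (`rcMeasure_real_anti_wired_of_isLowerSet`, `D` decreasing) and shrink the
domain to `EC` (`rcMeasure_real_le_fromEdgeSet_of_isLowerSet`); sum over the disjoint datum events.
Everything is proved; no definitions.

## References

* H. Kesten, The incipient infinite cluster in two-dimensional percolation, *Probab. Theory Related
  Fields* 73 (1986) 369–394: Lemma (29), proof of Lemma (23).
* G. Grimmett, *The Random-Cluster Model*, Springer (2006): Lemma (4.13), Lemma (4.14).
* D. Basu, A. Sapozhnikov, Kesten's incipient infinite cluster and quasi-multiplicativity of crossing
  probabilities, *Electron. Commun. Probab.* 22 (2017) no. 26, §2.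
-/

noncomputable section

open MeasureTheory Finset SimpleGraph
open Literature.Probability.Percolation (BondConfig openConnIn openGraph explSet explRim explEvent)

namespace Literature.Probability.LatticeModels

variable {V : Type*}

/-! ### The wiring event of a datum and the separator -/

section Combinatorics

/-- The event "the rim `Y` is wired from inside through `X`" (`explRimWired` on the datum event
`{𝒞 = X, 𝒟 = Y}`) is determined by the edges touching `X`. [folklore] -/
theorem mem_rimWiring_of_agree_on_touching {X Y : Set V} {ω₁ ω₂ : BondConfig V}
    (hagree : ∀ e : Sym2 V, (∃ v ∈ X, v ∈ e) → (e ∈ ω₁ ↔ e ∈ ω₂))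
    (h : ω₁ ∈ {ω : BondConfig V | ∀ r ∈ Y, ∀ r' ∈ Y, ∃ v ∈ X, ∃ v' ∈ X,
      s(v, r) ∈ ω ∧ s(v', r') ∈ ω ∧ ω ∈ openConnIn X v v'}) :
    ω₂ ∈ {ω : BondConfig V | ∀ r ∈ Y, ∀ r' ∈ Y, ∃ v ∈ X, ∃ v' ∈ X,
      s(v, r) ∈ ω ∧ s(v', r') ∈ ω ∧ ω ∈ openConnIn X v v'} := by
  intro r hr r' hr'
  obtain ⟨v, hv, v', hv', hvr, hv'r', hvv'⟩ := h r hr r' hr'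
  refine ⟨v, hv, v', hv', (hagree _ ⟨v, hv, Sym2.mem_mk_left v r⟩).1 hvr,
    (hagree _ ⟨v', hv', Sym2.mem_mk_left v' r'⟩).1 hv'r', ?_⟩
  exact Percolation.BlockExploration.openConnIn_of_agree hvv' fun a ha b _ hab ↦
    (hagree _ ⟨a, ha, Sym2.mem_mk_left a b⟩).1 hab

/-- **An open separator in the collar wires the rim of the outside-in exploration** (Kesten 1986,
proof of Lemma (23), via `explRimWired_of_separating`): on a lattice configuration `ω ⊆ E(⟨E⟩)`, if
some `P ⊆ Ann` is pairwise open-connected inside `Ann` and meets every `⟨E⟩`-walk from `Core` to the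
outside of `Core ∪ Ann`, then exploring `Ann` from `Rest = (Core ∪ Ann)ᶜ`, any two rim vertices hang
through open edges off two explored vertices joined inside the explored set (an open walk
`Rest → Core` read backwards is an `⟨E⟩`-walk `Core → Rest`).
[cite: Kesten1986, Lemma (29) and proof of Lemma (23)] -/
theorem rimWiring_of_separator {E : Finset (Sym2 V)} {Core Ann Rest : Set V}
    (hRest : ∀ v, v ∈ Rest ↔ v ∉ Core ∧ v ∉ Ann) {ω : BondConfig V}
    (hω : ω ⊆ (fromEdgeSet (E : Set (Sym2 V))).edgeSet) {P : Set V} (hP : P ⊆ Ann)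
    (hPconn : ∀ a ∈ P, ∀ b ∈ P, ω ∈ openConnIn Ann a b)
    (hPsep : ∀ (a b : V), a ∈ Core → b ∉ Core ∪ Ann →
      ∀ w : (fromEdgeSet (E : Set (Sym2 V))).Walk a b, ∃ z ∈ w.support, z ∈ P) :
    ω ∈ {ω : BondConfig V | ∀ r ∈ explRim Rest Ann ω, ∀ r' ∈ explRim Rest Ann ω,
      ∃ v ∈ explSet Rest Ann ω, ∃ v' ∈ explSet Rest Ann ω,
        s(v, r) ∈ ω ∧ s(v', r') ∈ ω ∧ ω ∈ openConnIn (explSet Rest Ann ω) v v'} := by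
  refine Percolation.explRimWired_of_separating P hP
    (fun a ha b hb ↦ Percolation.openConnIn_mono Set.subset_union_right _ _ (hPconn a ha b hb))
    fun u w hu hw p ↦ ?_
  have hwC : w ∈ Core := by
    by_contra h
    exact hw (Or.inl ((hRest w).2 ⟨h, fun h' ↦ hw (Or.inr h')⟩))
  have huCA : u ∉ Core ∪ Ann := by
    rintro (h | h)
    · exact ((hRest u).1 hu).1 h
    · exact ((hRest u).1 hu).2 h
  have hpE : ∀ e ∈ p.edges, e ∈ (fromEdgeSet (E : Set (Sym2 V))).edgeSet :=
    fun e he ↦ hω (Percolation.mem_of_mem_walk_edges p he)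
  obtain ⟨z, hz, hzP⟩ := hPsep w u hwC huCA (p.transfer _ hpE).reverse
  rw [Walk.support_reverse, List.mem_reverse, Walk.support_transfer] at hz
  exact ⟨z, hz, hzP⟩

end Combinatorics

/-! ### The collar estimate for the free measure -/

section Collar

variable [Fintype V] [DecidableEq V]

/-- **Domain Markov on a datum of the outside-in exploration whose rim is wired from inside, for
decreasing core events** (Kesten 1986, proof of Lemma (23); Grimmett 2006, Lemma (4.13)–(4.14)): on
the datum event `{𝒞 = X, 𝒟 = Y}` cut by the wiring event, the configuration off `X` is the
random-cluster configuration of the genuine edges off `X` with `Y` wired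
(`rcMeasure_real_inter_eq_mul_of_rim_wired`); for a decreasing `D` determined on the core edges `EC`
the wiring may be dropped and the domain shrunk to `EC`, whence
`φ^∅_{⟨E⟩}(D ∩ {𝒞 = X, 𝒟 = Y} ∩ Wd) ≤ φ^∅_{⟨E⟩}({𝒞 = X, 𝒟 = Y} ∩ Wd) · φ^∅_{⟨EC⟩}(D)` (`p < 1`).
[cite: Kesten1986, Lemma (29) and proof of Lemma (23)] -/
theorem rcMeasure_real_inter_explEvent_rimWiring_le {p q : ℝ} (hp : p ∈ Set.Icc (0 : ℝ) 1)
    (hp1 : p < 1) (hq : 1 ≤ q) (E EC : Finset (Sym2 V)) (Core Ann Rest : Set V)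
    (hCA : ∀ v ∈ Core, v ∉ Ann) (hRest : ∀ v, v ∈ Rest ↔ v ∉ Core ∧ v ∉ Ann)
    (hEC : ∀ e, e ∈ EC ↔ e ∈ E ∧ ∀ x ∈ e, x ∈ Core) {D : Set (BondConfig V)} (hD : IsLowerSet D)
    (hDdet : ∀ ω₁ ω₂ : BondConfig V, (∀ e ∈ EC, (e ∈ ω₁ ↔ e ∈ ω₂)) → (ω₁ ∈ D ↔ ω₂ ∈ D))
    (X Y : Set V) :
    (rcMeasure (fromEdgeSet (E : Set (Sym2 V))) p q ∅).real
        (D ∩ (explEvent Rest Ann X Y ∩ {ω : BondConfig V | ∀ r ∈ Y, ∀ r' ∈ Y, ∃ v ∈ X, ∃ v' ∈ X,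
          s(v, r) ∈ ω ∧ s(v', r') ∈ ω ∧ ω ∈ openConnIn X v v'})) ≤
      (rcMeasure (fromEdgeSet (E : Set (Sym2 V))) p q ∅).real
        (explEvent Rest Ann X Y ∩ {ω : BondConfig V | ∀ r ∈ Y, ∀ r' ∈ Y, ∃ v ∈ X, ∃ v' ∈ X,
          s(v, r) ∈ ω ∧ s(v', r') ∈ ω ∧ ω ∈ openConnIn X v v'}) *
        (rcMeasure (fromEdgeSet (EC : Set (Sym2 V))) p q ∅).real D := by
  classical
  have hq0 : 0 < q := one_pos.trans_le hq
  set F : Set (BondConfig V) := explEvent Rest Ann X Y ∩ {ω : BondConfig V | ∀ r ∈ Y, ∀ r' ∈ Y,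
    ∃ v ∈ X, ∃ v' ∈ X, s(v, r) ∈ ω ∧ s(v', r') ∈ ω ∧ ω ∈ openConnIn X v v'} with hFdef
  by_cases hne : F.Nonempty
  swap
  · rw [Set.not_nonempty_iff_eq_empty.1 hne, Set.inter_empty, measureReal_empty, zero_mul]
  obtain ⟨ω₀, hω₀⟩ := hne
  -- `D` is determined by the `E`-edges inside the core
  have hDdet' : ∀ ω₁ ω₂ : BondConfig V, (∀ e ∈ E, (∀ x ∈ e, x ∈ Core) → (e ∈ ω₁ ↔ e ∈ ω₂)) →
      (ω₁ ∈ D ↔ ω₂ ∈ D) :=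
    fun ω₁ ω₂ h ↦ hDdet ω₁ ω₂ fun e he ↦ h e ((hEC e).1 he).1 ((hEC e).1 he).2
  obtain ⟨U, hU, hUE, hAgree⟩ := exists_region_off_explSet hCA hRest hω₀.1.1 hDdet'
  have hXsub : X ⊆ Rest ∪ Ann := hω₀.1.1 ▸ Percolation.explSet_subset Rest Ann ω₀
  have hCX : ∀ v ∈ Core, v ∉ X := fun v hv hvX ↦
    (hXsub hvX).elim (fun h ↦ ((hRest v).1 h).1 hv) (fun h ↦ hCA v hv h)
  -- the free rim Markov property on the datum event cut by the wiring event
  have hMarkov := rcMeasure_real_inter_eq_mul_of_rim_wired (fromEdgeSet (E : Set (Sym2 V))) hp hq0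
    (W := Y) (X := Xᶜ) U (hUE _) (fun e he x hx ↦ ((hU e).1 he).2 x hx) F ?_ ?_ ?_ D
  rotate_left
  · -- `F` is determined off `U`
    intro ω₁ ω₂ h
    have hag : ∀ e : Sym2 V, (∃ v ∈ X, v ∈ e) → (e ∈ ω₁ ↔ e ∈ ω₂) := by
      intro e ⟨v, hv, hve⟩
      have heU : e ∈ (↑U : Set (Sym2 V))ᶜ := fun heU ↦
        ((hU e).1 (Finset.mem_coe.1 heU)).2 v hve hv
      constructor
      · intro h1
        have h' : e ∈ ω₁ ∩ (↑U : Set (Sym2 V))ᶜ := ⟨h1, heU⟩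
        rw [h] at h'
        exact h'.1
      · intro h2
        have h' : e ∈ ω₂ ∩ (↑U : Set (Sym2 V))ᶜ := ⟨h2, heU⟩
        rw [← h] at h'
        exact h'.1
    exact and_congr (Percolation.mem_explEvent_iff_of_agree_on_touching hag)
      ⟨mem_rimWiring_of_agree_on_touching hag,
        mem_rimWiring_of_agree_on_touching fun e he ↦ (hag e he).symm⟩
  · -- the open edges off `U` touch `Xᶜ` only at the rim `Y`
    intro ζ hζ hζF e he x hx hxX
    have heE := Finset.mem_sdiff.1 (hζ he)
    have hex : ∃ y ∈ e, y ∈ X := by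
      by_contra hne
      push Not at hne
      obtain ⟨heE', hnd⟩ := (mem_edgeFinset_fromEdgeSet_iff E _ e).1 heE.1
      refine heE.2 ((hU e).2 ⟨?_, hne⟩)
      rw [edgeSet_fromEdgeSet]
      exact ⟨Finset.mem_coe.2 heE', hnd⟩
    obtain ⟨y, hye, hyX⟩ := hex
    have hxy : x ≠ y := fun h ↦ hxX (h ▸ hyX)
    have he_eq : e = s(x, y) := (Sym2.mem_and_mem_iff hxy).1 ⟨hx, hye⟩
    have hyx : s(y, x) ∈ (↑ζ : BondConfig V) := by
      rw [Sym2.eq_swap, ← he_eq]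
      exact Finset.mem_coe.2 he
    exact Percolation.mem_of_mem_explEvent_of_open_edge hζF.1 hyX hyx hxX
  · -- the rim is wired through the open edges touching `X`
    intro ζ _ hζF x hx y hy
    obtain ⟨v, hv, v', hv', hvx, hv'y, hvv'⟩ := hζF.2 x hx y hy
    obtain ⟨hE1, hE2⟩ := Percolation.mem_explEvent_iff.1 hζF.1
    have hdisj := Percolation.disjoint_explSet_explRim Rest Ann (↑ζ : BondConfig V)
    rw [hE1, hE2] at hdisj
    have hne : ∀ {a b : V}, a ∈ X → b ∈ Y → a ≠ b :=
      fun ha hb h ↦ Set.disjoint_left.1 hdisj ha (h ▸ hb)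
    have h1 : (fromEdgeSet (ζ : Set (Sym2 V))).Reachable x v :=
      Adj.reachable ((fromEdgeSet_adj _).2 ⟨by rw [Sym2.eq_swap]; exact hvx, (hne hv hx).symm⟩)
    have h3 : (fromEdgeSet (ζ : Set (Sym2 V))).Reachable v' y :=
      Adj.reachable ((fromEdgeSet_adj _).2 ⟨hv'y, hne hv' hy⟩)
    obtain ⟨w, -⟩ := Percolation.BlockExploration.exists_openWalk_of_mem_openConnIn hvv'
    have h2 : (fromEdgeSet (ζ : Set (Sym2 V))).Reachable v v' := ⟨w⟩
    exact h1.trans (h2.trans h3)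
  -- shrink: drop the wiring of `Y`, then restrict the free measure of `⟨U⟩` to the core edges
  set EC' : Finset (Sym2 V) := EC.filter (fun e ↦ ¬ e.IsDiag) with hEC'def
  have hEC'mem : ∀ e, e ∈ EC' ↔ e ∈ EC ∧ ¬ e.IsDiag := fun e ↦ Finset.mem_filter
  have hGC : fromEdgeSet (EC' : Set (Sym2 V)) = fromEdgeSet (EC : Set (Sym2 V)) := by
    ext u v
    simp only [fromEdgeSet_adj, Finset.mem_coe, hEC'mem, Sym2.mk_isDiag_iff]
    tauto
  have hEC'U : ∀ i : Fintype (fromEdgeSet (U : Set (Sym2 V))).edgeSet,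
      EC' ⊆ @edgeFinset V (fromEdgeSet (U : Set (Sym2 V))) i := by
    intro i e he
    obtain ⟨heC, hnd⟩ := (hEC'mem e).1 he
    obtain ⟨heE, heCore⟩ := (hEC e).1 heC
    refine (mem_edgeFinset_fromEdgeSet_iff U i e).2 ⟨(hU e).2 ⟨?_, fun x hx hxX ↦ ?_⟩, hnd⟩
    · rw [edgeSet_fromEdgeSet]
      exact ⟨Finset.mem_coe.2 heE, hnd⟩
    · exact hCX x (heCore x hx) hxX
  have hshrink : (rcMeasure (fromEdgeSet (U : Set (Sym2 V))) p q Y).real D ≤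
      (rcMeasure (fromEdgeSet (EC : Set (Sym2 V))) p q ∅).real D := by
    calc (rcMeasure (fromEdgeSet (U : Set (Sym2 V))) p q Y).real D
        ≤ (rcMeasure (fromEdgeSet (U : Set (Sym2 V))) p q ∅).real D :=
          rcMeasure_real_anti_wired_of_isLowerSet _ hp hq (Set.empty_subset Y) hD
      _ = (rcMeasure (fromEdgeSet (U : Set (Sym2 V))) p q ∅).real {ω | ω ∩ ↑EC' ∈ D} := by
          refine measureReal_congr <|
            rcMeasure_ae_eq_of_forall_subset_edgeSet _ hp hq0 ∅ fun ω hω ↦ ?_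
          exact (hDdet (ω ∩ ↑EC') ω fun e heC ↦ ⟨fun h ↦ h.1, fun h ↦ ⟨h, Finset.mem_coe.2
            ((hEC'mem e).2 ⟨heC, not_isDiag_of_mem_edgeSet _ (hω h)⟩)⟩⟩).symm
      _ ≤ (rcMeasure (fromEdgeSet (EC' : Set (Sym2 V))) p q ∅).real D :=
          rcMeasure_real_le_fromEdgeSet_of_isLowerSet _ hp hq ∅ EC' (hEC'U _)
            (rcMeasure_real_cylinder_empty_pos _ hp hp1 hq0 ∅ EC') hD
      _ = (rcMeasure (fromEdgeSet (EC : Set (Sym2 V))) p q ∅).real D := by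
          rw [rcMeasure_congr_graph hGC]
  calc (rcMeasure (fromEdgeSet (E : Set (Sym2 V))) p q ∅).real (D ∩ F)
      = (rcMeasure (fromEdgeSet (E : Set (Sym2 V))) p q ∅).real ({ω | ω ∩ ↑U ∈ D} ∩ F) :=
        measureReal_congr <| rcMeasure_ae_eq_of_forall_subset_edgeSet _ hp hq0 ∅ fun ω hω ↦ by
          simp only [Set.mem_inter_iff, Set.mem_setOf_eq, hAgree ω hω]
    _ = (rcMeasure (fromEdgeSet (E : Set (Sym2 V))) p q ∅).real F *
          (rcMeasure (fromEdgeSet (U : Set (Sym2 V))) p q Y).real D := hMarkov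
    _ ≤ _ := mul_le_mul_of_nonneg_left hshrink measureReal_nonneg

/-- **Step 2 for the free measure: on the separator event, a decreasing core event costs at most its
free-core probability** (Kesten 1986, proof of Lemma (23)): `φ^∅_{⟨E⟩}(D ∩ Sep) ≤ φ^∅_{⟨EC⟩}(D)` for
decreasing `D` determined on `EC` (`p < 1`, `q ≥ 1`) — cover `Sep` by the datum events of the
outside-in exploration cut by their wiring events (`rimWiring_of_separator`), bound each piece by
`rcMeasure_real_inter_explEvent_rimWiring_le`, and sum the disjoint datum events.
[cite: Kesten1986, Lemma (29) and proof of Lemma (23)] -/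
theorem rcMeasure_real_inter_separator_le_free_core {p q : ℝ} (hp : p ∈ Set.Icc (0 : ℝ) 1)
    (hp1 : p < 1) (hq : 1 ≤ q) (E EC : Finset (Sym2 V)) (Core Ann : Set V)
    (hCA : ∀ v ∈ Core, v ∉ Ann) (hEC : ∀ e, e ∈ EC ↔ e ∈ E ∧ ∀ x ∈ e, x ∈ Core)
    {D : Set (BondConfig V)} (hD : IsLowerSet D)
    (hDdet : ∀ ω₁ ω₂ : BondConfig V, (∀ e ∈ EC, (e ∈ ω₁ ↔ e ∈ ω₂)) → (ω₁ ∈ D ↔ ω₂ ∈ D)) :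
    (rcMeasure (fromEdgeSet (E : Set (Sym2 V))) p q ∅).real
        (D ∩ {ω | ∃ P : Set V, P ⊆ Ann ∧ (∀ a ∈ P, ∀ b ∈ P, ω ∈ openConnIn Ann a b) ∧
          ∀ (a b : V), a ∈ Core → b ∉ Core ∪ Ann →
            ∀ w : (fromEdgeSet (E : Set (Sym2 V))).Walk a b, ∃ z ∈ w.support, z ∈ P}) ≤
      (rcMeasure (fromEdgeSet (EC : Set (Sym2 V))) p q ∅).real D := by
  classical
  have hq0 : 0 < q := one_pos.trans_le hq
  haveI := isProbabilityMeasure_rcMeasure (fromEdgeSet (E : Set (Sym2 V))) hp hq0 (∅ : Set V)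
  set Rest : Set V := {v | v ∉ Core ∧ v ∉ Ann} with hRest
  have hRest' : ∀ v, v ∈ Rest ↔ v ∉ Core ∧ v ∉ Ann := fun v ↦ Iff.rfl
  set F : Set V × Set V → Set (BondConfig V) := fun XY ↦ explEvent Rest Ann XY.1 XY.2 ∩
    {ω : BondConfig V | ∀ r ∈ XY.2, ∀ r' ∈ XY.2, ∃ v ∈ XY.1, ∃ v' ∈ XY.1,
      s(v, r) ∈ ω ∧ s(v', r') ∈ ω ∧ ω ∈ openConnIn XY.1 v v'} with hFdef
  -- (i) on the separator event the rim is wired from inside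
  have h1 : (rcMeasure (fromEdgeSet (E : Set (Sym2 V))) p q ∅).real
        (D ∩ {ω | ∃ P : Set V, P ⊆ Ann ∧ (∀ a ∈ P, ∀ b ∈ P, ω ∈ openConnIn Ann a b) ∧
          ∀ (a b : V), a ∈ Core → b ∉ Core ∪ Ann →
            ∀ w : (fromEdgeSet (E : Set (Sym2 V))).Walk a b, ∃ z ∈ w.support, z ∈ P}) ≤
      (rcMeasure (fromEdgeSet (E : Set (Sym2 V))) p q ∅).real
        (⋃ XY ∈ (Finset.univ : Finset (Set V × Set V)), (D ∩ F XY)) := by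
    refine rcMeasure_real_mono_of_forall_subset_edgeSet _ hp hq0 ∅ fun ω hω hωD ↦ ?_
    obtain ⟨hωD, P, hP, hPconn, hPsep⟩ := hωD
    exact Set.mem_iUnion₂.2 ⟨(explSet Rest Ann ω, explRim Rest Ann ω), Finset.mem_univ _, hωD,
      ⟨rfl, rfl⟩, rimWiring_of_separator hRest' hω hP hPconn hPsep⟩
  -- (ii) the datum events are pairwise disjoint
  have hdisj : (↑(Finset.univ : Finset (Set V × Set V)) : Set (Set V × Set V)).PairwiseDisjoint F :=
    fun XY _ XY' _ hne ↦ (Percolation.disjoint_explEvent fun h ↦ hne (Prod.ext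
      (congrArg Prod.fst h) (congrArg Prod.snd h))).mono Set.inter_subset_left Set.inter_subset_left
  have h4 : ∑ XY ∈ (Finset.univ : Finset (Set V × Set V)),
        (rcMeasure (fromEdgeSet (E : Set (Sym2 V))) p q ∅).real (F XY) =
      (rcMeasure (fromEdgeSet (E : Set (Sym2 V))) p q ∅).real
        (⋃ XY ∈ (Finset.univ : Finset (Set V × Set V)), F XY) :=
    (measureReal_biUnion_finset hdisj fun _ _ ↦ MeasurableSet.of_discrete).symm
  have h5 : (rcMeasure (fromEdgeSet (E : Set (Sym2 V))) p q ∅).real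
      (⋃ XY ∈ (Finset.univ : Finset (Set V × Set V)), F XY) ≤ 1 := measureReal_le_one
  calc (rcMeasure (fromEdgeSet (E : Set (Sym2 V))) p q ∅).real
        (D ∩ {ω | ∃ P : Set V, P ⊆ Ann ∧ (∀ a ∈ P, ∀ b ∈ P, ω ∈ openConnIn Ann a b) ∧
          ∀ (a b : V), a ∈ Core → b ∉ Core ∪ Ann →
            ∀ w : (fromEdgeSet (E : Set (Sym2 V))).Walk a b, ∃ z ∈ w.support, z ∈ P})
      ≤ _ := h1
    _ ≤ ∑ XY ∈ (Finset.univ : Finset (Set V × Set V)),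
          (rcMeasure (fromEdgeSet (E : Set (Sym2 V))) p q ∅).real (D ∩ F XY) :=
        measureReal_biUnion_finset_le _ _
    _ ≤ ∑ XY ∈ (Finset.univ : Finset (Set V × Set V)),
          (rcMeasure (fromEdgeSet (E : Set (Sym2 V))) p q ∅).real (F XY) *
            (rcMeasure (fromEdgeSet (EC : Set (Sym2 V))) p q ∅).real D :=
        Finset.sum_le_sum fun XY _ ↦ rcMeasure_real_inter_explEvent_rimWiring_le hp hp1 hq E EC
          Core Ann Rest hCA hRest' hEC hD hDdet XY.1 XY.2
    _ = (∑ XY ∈ (Finset.univ : Finset (Set V × Set V)),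
          (rcMeasure (fromEdgeSet (E : Set (Sym2 V))) p q ∅).real (F XY)) *
            (rcMeasure (fromEdgeSet (EC : Set (Sym2 V))) p q ∅).real D :=
        (Finset.sum_mul _ _ _).symm
    _ ≤ 1 * (rcMeasure (fromEdgeSet (EC : Set (Sym2 V))) p q ∅).real D :=
        mul_le_mul_of_nonneg_right (h4 ▸ h5) measureReal_nonneg
    _ = _ := one_mul _

/-- **Step 1 for the free measure: a core event does not suppress the separator** (Kesten 1986,
proof of Lemma (23)): if conditionally on every cylinder of the edges off `EA` the separator event has
`φ^∅_{⟨E⟩}`-probability `≥ c`, then `φ^∅_{⟨E⟩}(Sepᶜ ∩ D) ≤ (1 - c) φ^∅_{⟨E⟩}(D)` for every event `D`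
determined on the core edges `EC` (sum over the cylinders of `D`, which is determined off `EA`).
[cite: Kesten1986, Lemma (29) and proof of Lemma (23)] -/
theorem rcMeasure_real_compl_separator_inter_le {p q : ℝ} (hp : p ∈ Set.Icc (0 : ℝ) 1)
    (hq : 1 ≤ q) (E EA EC : Finset (Sym2 V)) (Core Ann : Set V) (hCA : ∀ v ∈ Core, v ∉ Ann)
    (hEA : ∀ e, e ∈ EA ↔ e ∈ E ∧ ∃ v ∈ Ann, v ∈ e)
    (hEC : ∀ e, e ∈ EC ↔ e ∈ E ∧ ∀ x ∈ e, x ∈ Core) {Sep : Set (BondConfig V)} {c : ℝ}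
    (hSep : ∀ ξ : Finset (Sym2 V), ξ ⊆ E \ EA →
      c * (rcMeasure (fromEdgeSet (E : Set (Sym2 V))) p q ∅).real
          {ω | ω ∩ (↑EA : Set (Sym2 V))ᶜ = ↑ξ} ≤
        (rcMeasure (fromEdgeSet (E : Set (Sym2 V))) p q ∅).real
          (Sep ∩ {ω | ω ∩ (↑EA : Set (Sym2 V))ᶜ = ↑ξ}))
    {D : Set (BondConfig V)}
    (hDdet : ∀ ω₁ ω₂ : BondConfig V, (∀ e ∈ EC, (e ∈ ω₁ ↔ e ∈ ω₂)) → (ω₁ ∈ D ↔ ω₂ ∈ D)) :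
    (rcMeasure (fromEdgeSet (E : Set (Sym2 V))) p q ∅).real (Sepᶜ ∩ D) ≤
      (1 - c) * (rcMeasure (fromEdgeSet (E : Set (Sym2 V))) p q ∅).real D := by
  classical
  have hq0 : 0 < q := one_pos.trans_le hq
  haveI := isProbabilityMeasure_rcMeasure (fromEdgeSet (E : Set (Sym2 V))) hp hq0 (∅ : Set V)
  -- `D` is determined off `EA`
  have hD' : ∀ ω₁ ω₂ : BondConfig V, ω₁ ∩ (↑EA)ᶜ = ω₂ ∩ (↑EA)ᶜ → (ω₁ ∈ D ↔ ω₂ ∈ D) := by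
    intro ω₁ ω₂ h
    refine hDdet ω₁ ω₂ fun e heC ↦ ?_
    have heA : e ∈ (↑EA : Set (Sym2 V))ᶜ := by
      intro heA
      obtain ⟨-, v, hvA, hve⟩ := (hEA e).1 (Finset.mem_coe.1 heA)
      exact hCA v (((hEC e).1 heC).2 v hve) hvA
    constructor
    · intro h1
      have h' : e ∈ ω₁ ∩ (↑EA : Set (Sym2 V))ᶜ := ⟨h1, heA⟩
      rw [h] at h'
      exact h'.1
    · intro h2
      have h' : e ∈ ω₂ ∩ (↑EA : Set (Sym2 V))ᶜ := ⟨h2, heA⟩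
      rw [← h] at h'
      exact h'.1
  refine rcMeasure_real_inter_le_mul_of_cylinder_le (fromEdgeSet (E : Set (Sym2 V))) hp hq0 ∅ EA hD'
    fun ξ hξ ↦ ?_
  have hξ' : ξ ⊆ E \ EA := by
    intro e he
    obtain ⟨heG, heA⟩ := Finset.mem_sdiff.1 (hξ he)
    exact Finset.mem_sdiff.2 ⟨((mem_edgeFinset_fromEdgeSet_iff E _ e).1 heG).1, heA⟩
  have hc := hSep ξ hξ'
  have hsplit := measureReal_inter_add_sdiff (μ := rcMeasure (fromEdgeSet (E : Set (Sym2 V))) p q ∅)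
    (s := {ω : BondConfig V | ω ∩ (↑EA : Set (Sym2 V))ᶜ = ↑ξ}) (t := Sep) MeasurableSet.of_discrete
  rw [Set.inter_comm] at hc
  rw [Set.inter_comm, ← Set.sdiff_eq]
  linarith

/-- **(B) Big-free versus core-free for decreasing core events across a collar with open
separators**
(Kesten 1986, Lemma (29) and proof of Lemma (23), for the random-cluster measure, `q ≥ 1`,
`0 ≤ p < 1`): if under the free measure of `⟨E⟩`, conditionally on every cylinder of the edges off the
collar edges `EA`, an open separator of the collar has probability `≥ c`, then for every decreasing
event `D` determined on the core edges `EC`, `c · φ^∅_{⟨E⟩}(D) ≤ φ^∅_{⟨EC⟩}(D)`.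
[cite: Kesten1986, Lemma (29) and proof of Lemma (23)] -/
theorem rcMeasure_real_free_le_free_core_of_sepBound : ∀ {V : Type*} [Fintype V] [DecidableEq V] {p q : ℝ}, p ∈ Set.Ico (0 : ℝ) 1 → 1 ≤ q → ∀ (E EA EC : Finset (Sym2 V)) (Core Ann : Set V), (∀ v ∈ Core, v ∉ Ann) → (∀ e ∈ E, (∃ v ∈ Core, v ∈ e) → ∀ x ∈ e, x ∈ Core ∨ x ∈ Ann) → (∀ e, e ∈ EA ↔ e ∈ E ∧ ∃ v ∈ Ann, v ∈ e) → (∀ e, e ∈ EC ↔ e ∈ E ∧ ∀ x ∈ e, x ∈ Core) → ∀ {c : ℝ}, 0 < c → (∀ ξ : Finset (Sym2 V), ξ ⊆ E \ EA → c * (Literature.Probability.LatticeModels.rcMeasure (SimpleGraph.fromEdgeSet (E : Set (Sym2 V))) p q ∅).real {ω | ω ∩ (↑EA : Set (Sym2 V))ᶜ = ↑ξ} ≤ (Literature.Probability.LatticeModels.rcMeasure (SimpleGraph.fromEdgeSet (E : Set (Sym2 V))) p q ∅).real ({ω | ∃ P : Set V, P ⊆ Ann ∧ (∀ a ∈ P,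 ∀ b ∈ P, ω ∈ Literature.Probability.Percolation.openConnIn Ann a b) ∧ ∀ (a b : V), a ∈ Core → b ∉ Core ∪ Ann → ∀ w : (SimpleGraph.fromEdgeSet (E : Set (Sym2 V))).Walk a b, ∃ z ∈ w.support, z ∈ P} ∩ {ω | ω ∩ (↑EA : Set (Sym2 V))ᶜ = ↑ξ})) → ∀ {D : Set (Literature.Probability.Percolation.BondConfig V)}, IsLowerSet D → (∀ ω₁ ω₂ : Literature.Probability.Percolation.BondConfig V, (∀ e ∈ EC, (e ∈ ω₁ ↔ e ∈ ω₂)) → (ω₁ ∈ D ↔ ω₂ ∈ D)) → c * (Literature.Probability.LatticeModels.rcMeasure (SimpleGraph.fromEdgeSet (E : Set (Sym2 V))) p q ∅).real D ≤ (Literature.Probability.LatticeModels.rcMeasure (SimpleGraph.fromEdgeSet (EC : Set (Sym2 V))) p q ∅).real D := by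
  intro V _ _ p q hp hq E EA EC Core Ann hCA hCore hEA hEC c hc hSep D hD hDdet
  have hp' : p ∈ Set.Icc (0 : ℝ) 1 := ⟨hp.1, hp.2.le⟩
  have hq0 : 0 < q := one_pos.trans_le hq
  haveI := isProbabilityMeasure_rcMeasure (fromEdgeSet (E : Set (Sym2 V))) hp' hq0 (∅ : Set V)
  have hS1 := rcMeasure_real_compl_separator_inter_le hp' hq E EA EC Core Ann hCA hEA hEC hSep hDdet
  have hS2 := rcMeasure_real_inter_separator_le_free_core hp' hp.2 hq E EC Core Ann hCA hEC hD hDdet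
  have hsplit := measureReal_inter_add_sdiff (μ := rcMeasure (fromEdgeSet (E : Set (Sym2 V))) p q ∅)
    (s := D) (t := {ω | ∃ P : Set V, P ⊆ Ann ∧ (∀ a ∈ P, ∀ b ∈ P, ω ∈ openConnIn Ann a b) ∧
      ∀ (a b : V), a ∈ Core → b ∉ Core ∪ Ann →
        ∀ w : (fromEdgeSet (E : Set (Sym2 V))).Walk a b, ∃ z ∈ w.support, z ∈ P})
    MeasurableSet.of_discrete
  rw [Set.sdiff_eq, Set.inter_comm D (_ᶜ)] at hsplit
  linarith

end Collar

end Literature.Probability.LatticeModels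

end
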